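import Summits.QuantumFields.BalabanUV.Beta.GAN24.RespInnerBondKernel
import Summits.QuantumFields.BalabanUV.Beta.GAN24.SlotColumnTwoFaceWord

/-!
# `BalabanUV.Beta.GAN24.RespWordCellForm` — binder row G-an2-4 ∕ (CONV-C), W-slot CT-W, conservation law (C)∕(C)sym, step (L3c)(vi) of this lineage's note
# `HOME/b2b-balaban-gan24-formalise-leaf-04/g66/CSYM-LEVEL0-KERNEL-BLUEPRINT.md` §8: **THE OUTER-SUMMED SECOND-RESPONSE WORD IN CELL FORM** — for every bond `c`,
# `Σ'_{u′} FF[dM (K2OfK X̃♮_j Lc S M μ c) Lc S M ν u′] = Σ_{r∈box Lc} Σ_κ chg^{𝒦_μ}_ν(inl κ, r)·Φ_κ(r) + Σ_{ρ′} chg^{𝒦_μ}_ν(inr ρ′, 0)·Ψ_{ρ′}(0)`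
# with `𝒦_μ = −(X̃♮_j ∘ 𝒮_μ) ∘ X̃♮_j`, its column charges `chg^{𝒦_μ}_ν(g, t) = −Σ'_{s′} Σ_b (X̃♮_j ∘ 𝒮_μ)(t, s′)(g, b)·chg_ν(b, s′)`, and the two-leg face currents
# `Φ_κ(t) = Σ'_{(y,w)} ρ₁(y)ρ₂(w)·S κ t y w f g`, `Ψ_{ρ′}(w′) = Σ'_{(y,w)} ρ₁(y)ρ₂(w)·M ρ′ w′ y w f g`

NOT IN PRINT; OUR BOOKKEEPING ([folklore] tsum bookkeeping over TREE objects BY NAME: an2's `SecondOrderResponse.K2OfK_translate ∕ dM_shiftK_translate ∕ vertexFamily_K2OfK`, this lineage's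
22 `ExchangeSlotResum.tsum_eq_tsum_of_cov ∕ tsum_twoFace_shiftK`, 36 `SlotColumnTwoFaceWord.tsum_twoFace_dM_col ∕ tsum_col_twoFace_eq_sum_box ∕ tsum_colM_twoFace_eq_charge`, 37
`RespInnerBondKernel.hasSum_K2OfK_dressedStep_bond ∕ exists_decays_respKernel ∕ shiftK_respKernel ∕ hasSum_respKernel_col`, 15 `EEWordReduced.shiftK_dressedStep`, leaf-06's
`DMBondCharges.hasSum_fibre_swap ∕ decays_of_biLoc`; G-an2-4 formalisation swarm, leaf prover `b2b-balaban-gan24-formalise-leaf-04`, gen 67).  HONEST FRAMING (cell contract, verbatim):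
«discharging `BetaPertH` makes Bałaban's UV stability UNCONDITIONAL — a real constructive-QFT result; it is NOT the continuum limit and NOT the Clay problem.»  HONEST DEPENDENCY (verbatim):
«continuum YM on T⁴ ⇐ BetaPertH ∧ nine spine estimates (0/9 proved); BetaPertH ⇐ (D1) ∧ (D4) ∧ CAP+tail; G-an2-4 gates asym, D1 and NE2/3/4.»

WHY (blueprint §8 (L3c); journal [LEAF04-G67-INTENT35]).  (1) The two-face word `G(a, b) = FF[dM (K2_{μa}) Lc S M ν b]` is jointly block-covariant, so `Σ'_{u′} G(c, u′) = Σ'_{c′} G(c′, c)`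
(the lattice sum moves onto the INNER bond); (2) each `G(c′, c)` is the `(ν, c)`-column of the decaying kernel `K2_{μc′}` against the currents (36 §1), and the bond sum of those columns
is the column of `𝒦_μ` (37 §2; product majorants `e^{−(m/2)|t − Lc•c|}·e^{−(m/2)|Lc•c − Lc•c′|}`); (3) `𝒦_μ` is decaying and block-covariant, so 36 §2 regroups the `t`-sum over one cell
against the column CHARGES of `𝒦_μ` (37 §3).  The successor file symmetrises in `(μ, ν)`: the charges combine to `−X̃·(𝒥_{μν} + 𝒥_{νμ})`, whose field-leg source vanishes (35 §3).

WHAT ([folklore]; generic `d`; in-block root, `1 ≤ Lc`, every `j`, all units; `S` `LocStencil` ∕ `M` `VertexFamily` at positive rates, `S` block-covariant, `M` covariant; bounded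
`Lc`-periodic weights; 0 `def`, 0 cited facts, 0 `def … : Prop`, 0 sorry): §1 `respWord_cov` (joint covariance of `G`), **`tsum_respWord_outer_eq_inner`**; §2 GENERIC (any family `V c′` bi-localised at
`N•c′` with one constant and pointwise bond sum `𝒦`): `abs_family_col_le` (product majorant of the `(ν, c)`-column), `abs_twoFace_le`, `hasSum_family_col_stencil`,
`hasSum_family_col_vertexM`, **`hasSum_word_inner_col`** (`HasSum (c′ ↦ FF[dM (V c′) N S M ν c])
(Σ_κ Σ'_t 𝒦(t, N•c)(inl κ, inr ν)·Φ_κ(t) + Σ_{ρ′} Σ'_{w′} 𝒦(N•w′, N•c)(inr ρ′, inr ν)·Ψ_{ρ′}(w′))`); §3 **`tsum_respWord_eq_cell`** (the headline, at `V = K2OfK X̃♮_j Lc S M μ`).  Asserts NO value of Bałaban's tables; discharges NOTHING of (C)sym ∕ (Q-D) ∕ (Q-D-rate) ∕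
«T2Shape» ∕ «T2Drift» ∕ (hW, hWall); NEVER «G-an2-4 closed» as (CONV-C); NOT D1, NOT `BetaPertH`, NOT continuum, NOT Clay.  2026-08-23; no existing file touched.
-/

noncomputable section

open Finset
open scoped BigOperators
open Literature.MathematicalPhysics.QuantumFieldTheory
open Literature.MathematicalPhysics.QuantumFieldTheory.Balaban1983to89
open Literature.MathematicalPhysics.QuantumFieldTheory.Balaban1983to89.Beta
open AffineAveraging (Site box toSite)
open B12Sec2to5 (l1 l1_nonneg)
open ExpKernelCalculus (MKer comp Decays BiLoc VertexFamily Zl Zl_nonneg shiftK summable_exp_shift' l1_sub_triangle l1_sub_symm)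
open OneStepResolventKernel (Fib LocStencil decays_mono biLoc_mono)
open OneStepKernelFamily (KInvStep decays_KInvStep)
open BalabanStepJets (locStencil_mono)
open SecondOrderResponse (dM K2OfK K2OfK_translate dM_shiftK_translate vertexFamily_K2OfK cK2)
open Summit.QuantumFields.BalabanUV.Beta.HessKerDressedUnits (unitK decays_unitK)
open Summit.QuantumFields.BalabanUV.Beta.AxialDressingRooted (coDressKBmAt decays_coDressKBmAt)
open Summit.QuantumFields.BalabanUV.Beta.GAN24.DMBondCharges (hasSum_fibre_swap decays_of_biLoc)
open Summit.QuantumFields.BalabanUV.Beta.GAN24.KernelLegCharges (summable_exp_coarse)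
open Summit.QuantumFields.BalabanUV.Beta.GAN24.ResolventLegCharges (summable_exp_coarse')
open Summit.QuantumFields.BalabanUV.Beta.GAN24.EEWordReduced (shiftK_dressedStep)
open Summit.QuantumFields.BalabanUV.Beta.GAN24.ExchangeSlotResum (tsum_eq_tsum_of_cov tsum_twoFace_shiftK)
open Summit.QuantumFields.BalabanUV.Beta.GAN24.SlotColumnTwoFaceWord (hasSum_exp_pair tsum_twoFace_dM_col tsum_col_twoFace_eq_sum_box tsum_colM_twoFace_eq_charge)
open Summit.QuantumFields.BalabanUV.Beta.GAN24.RespInnerBondKernel (hasSum_K2OfK_dressedStep_bond exists_decays_respKernel shiftK_respKernel hasSum_respKernel_col)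

namespace Summit.QuantumFields.BalabanUV.Beta.GAN24.RespWordCellForm

variable {d : ℕ} {Lc : ℕ} [NeZero Lc] {r : Fin (d + 1) → ℕ} {ρ₁ ρ₂ : Site (d + 1) → ℝ}
  {S M : Fin (d + 1) → Site (d + 1) → MKer (d + 1) (Fib d)} {Cs δs CM δM : ℝ}

/-! ## §1 Joint block covariance: the lattice sum moves onto the inner bond -/

/-- [folklore] **THE TWO-FACE RESPONSE WORD IS JOINTLY BLOCK-COVARIANT**: `G(a + t, b + t) = G(a, b)` for `G(a, b) = Σ'_{(y,w)} ρ₁(y)ρ₂(w)·dM (K2OfK X̃♮_j Lc S M μ a) Lc S M ν b y w f g`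
(an2's `K2OfK_translate` + `dM_shiftK_translate`, then 22 `tsum_twoFace_shiftK`). -/
theorem respWord_cov (hLc : 1 ≤ Lc) (sf sm : ℝ) (j : ℕ)
    (hScov : ∀ (κ : Fin (d + 1)) (u t : Site (d + 1)), S κ (u + (Lc : ℤ) • t) = shiftK (-((Lc : ℤ) • t)) (S κ u))
    (hMcov : ∀ (ρ' : Fin (d + 1)) (w t : Site (d + 1)), M ρ' (w + t) = shiftK (-((Lc : ℤ) • t)) (M ρ' w))
    (hρ₁ : ∀ y s : Site (d + 1), ρ₁ (y + (Lc : ℤ) • s) = ρ₁ y) (hρ₂ : ∀ w s : Site (d + 1), ρ₂ (w + (Lc : ℤ) • s) = ρ₂ w)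
    (μ ν : Fin (d + 1)) (f g : Fib d) (a b t : Site (d + 1)) :
    (∑' yw : Site (d + 1) × Site (d + 1), ρ₁ yw.1 * ρ₂ yw.2 *
        dM (K2OfK (unitK sf sm (coDressKBmAt (toSite r) Lc (KInvStep (d := d) Lc j))) Lc S M μ (a + t)) Lc S M ν (b + t) yw.1 yw.2 f g) =
      ∑' yw : Site (d + 1) × Site (d + 1), ρ₁ yw.1 * ρ₂ yw.2 *
        dM (K2OfK (unitK sf sm (coDressKBmAt (toSite r) Lc (KInvStep (d := d) Lc j))) Lc S M μ a) Lc S M ν b yw.1 yw.2 f g := by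
  rw [K2OfK_translate (N := Lc) (fun t => shiftK_dressedStep (d := d) (r := r) hLc sf sm j t) hScov hMcov μ a t,
    dM_shiftK_translate (N := Lc) _ hScov hMcov ν b t]
  exact tsum_twoFace_shiftK (N := Lc) hρ₁ hρ₂ _ t f g

/-- [folklore] **THE LATTICE SUM OF THE OUTER BOND EQUALS THE LATTICE SUM OF THE INNER BOND**: `Σ'_{u′} G(c, u′) = Σ'_{c′} G(c′, c)` (22 `tsum_eq_tsum_of_cov`). -/
theorem tsum_respWord_outer_eq_inner (hLc : 1 ≤ Lc) (sf sm : ℝ) (j : ℕ)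
    (hScov : ∀ (κ : Fin (d + 1)) (u t : Site (d + 1)), S κ (u + (Lc : ℤ) • t) = shiftK (-((Lc : ℤ) • t)) (S κ u))
    (hMcov : ∀ (ρ' : Fin (d + 1)) (w t : Site (d + 1)), M ρ' (w + t) = shiftK (-((Lc : ℤ) • t)) (M ρ' w))
    (hρ₁ : ∀ y s : Site (d + 1), ρ₁ (y + (Lc : ℤ) • s) = ρ₁ y) (hρ₂ : ∀ w s : Site (d + 1), ρ₂ (w + (Lc : ℤ) • s) = ρ₂ w)
    (μ ν : Fin (d + 1)) (f g : Fib d) (c : Site (d + 1)) :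
    (∑' u' : Site (d + 1), ∑' yw : Site (d + 1) × Site (d + 1), ρ₁ yw.1 * ρ₂ yw.2 *
        dM (K2OfK (unitK sf sm (coDressKBmAt (toSite r) Lc (KInvStep (d := d) Lc j))) Lc S M μ c) Lc S M ν u' yw.1 yw.2 f g) =
      ∑' c' : Site (d + 1), ∑' yw : Site (d + 1) × Site (d + 1), ρ₁ yw.1 * ρ₂ yw.2 *
        dM (K2OfK (unitK sf sm (coDressKBmAt (toSite r) Lc (KInvStep (d := d) Lc j))) Lc S M μ c') Lc S M ν c yw.1 yw.2 f g :=
  (tsum_eq_tsum_of_cov (G := fun a b => ∑' yw : Site (d + 1) × Site (d + 1), ρ₁ yw.1 * ρ₂ yw.2 *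
      dM (K2OfK (unitK sf sm (coDressKBmAt (toSite r) Lc (KInvStep (d := d) Lc j))) Lc S M μ a) Lc S M ν b yw.1 yw.2 f g)
    (fun a b t => respWord_cov hLc sf sm j hScov hMcov hρ₁ hρ₂ μ ν f g a b t) c).symm

/-! ## §2 Generic: the inner-bond sum of the word through the columns of a centre-tied family with a pointwise bond sum -/

section Generic

variable {N : ℕ} [NeZero N] {V : Site (d + 1) → MKer (d + 1) (Fib d)} {𝒦 : MKer (d + 1) (Fib d)} {C2 m : ℝ}

omit [NeZero N] in
/-- [folklore] **PRODUCT MAJORANT OF THE `(ν, c)`-COLUMN OF A CENTRE-TIED FAMILY**: `BiLoc (V c′) (N•c′) (N•c′) C2 m` ⟹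
`|V c′ t (N•c) g (inr ν)| ≤ C2·e^{−(m/2)|t − N•c|}·e^{−(m/2)|N•c − N•c′|}` (triangle inequality). -/
theorem abs_family_col_le (hV : ∀ c', BiLoc (V c') ((N : ℤ) • c') ((N : ℤ) • c') C2 m) (hm : 0 ≤ m)
    (ν : Fin (d + 1)) (c c' t : Site (d + 1)) (g : Fib d) :
    |V c' t ((N : ℤ) • c) g (Sum.inr ν)| ≤ C2 * Real.exp (-(m / 2) * l1 (t - (N : ℤ) • c)) * Real.exp (-(m / 2) * l1 ((N : ℤ) • c - (N : ℤ) • c')) := by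
  have hC : 0 ≤ C2 := (hV c').nonneg (Sum.inl 0)
  refine (hV c' t ((N : ℤ) • c) g (Sum.inr ν)).trans ?_
  rw [mul_assoc, ← Real.exp_add]
  refine mul_le_mul_of_nonneg_left (Real.exp_le_exp.2 ?_) hC
  have htri := l1_sub_triangle t ((N : ℤ) • c') ((N : ℤ) • c)
  rw [l1_sub_symm ((N : ℤ) • c') ((N : ℤ) • c)] at htri
  nlinarith [l1_nonneg (t - (N : ℤ) • c'), l1_nonneg ((N : ℤ) • c - (N : ℤ) • c')]

omit [NeZero N] in
/-- [folklore] **THE TWO-LEG FACE CURRENT OF A KERNEL BI-LOCALISED AT ONE CENTRE IS BOUNDED** by `C·Zl(m)²` (bounded weights). -/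
theorem abs_twoFace_le {T : MKer (d + 1) (Fib d)} {p : Site (d + 1)} {CT : ℝ} (hm : 0 < m) (hT : BiLoc T p p CT m)
    (h₁ : ∀ y, |ρ₁ y| ≤ 1) (h₂ : ∀ w, |ρ₂ w| ≤ 1) (f g : Fib d) :
    |∑' yw : Site (d + 1) × Site (d + 1), ρ₁ yw.1 * ρ₂ yw.2 * T yw.1 yw.2 f g| ≤ CT * (Zl (d + 1) m * Zl (d + 1) m) := by
  have hCT : 0 ≤ CT := hT.nonneg f
  have hmaj := ((hasSum_exp_pair (d := d) hm p).mul_left CT)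
  have hb := tsum_of_norm_bounded hmaj (f := fun yw : Site (d + 1) × Site (d + 1) => ρ₁ yw.1 * ρ₂ yw.2 * T yw.1 yw.2 f g) (fun yw => ?_)
  · rw [Real.norm_eq_abs] at hb
    exact hb
  · rw [Real.norm_eq_abs, abs_mul, abs_mul]
    have h := hT yw.1 yw.2 f g
    rw [mul_add, Real.exp_add] at h
    calc |ρ₁ yw.1| * |ρ₂ yw.2| * |T yw.1 yw.2 f g| ≤ 1 * 1 * (CT * (Real.exp (-m * l1 (yw.1 - p)) * Real.exp (-m * l1 (yw.2 - p)))) :=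
          mul_le_mul (mul_le_mul (h₁ _) (h₂ _) (abs_nonneg _) zero_le_one) h (abs_nonneg _) (by norm_num)
      _ = _ := by ring

/-- [folklore] **FIELD HALF, ONE COLOUR: THE INNER-BOND SUM THROUGH THE `(ν, c)`-COLUMN** — one-sided Fubini over `(t, c′)` with the product majorant of `abs_family_col_le`
times the bound of the current; fibres by the pointwise bond sum `Σ'_{c′} V c′ = 𝒦`. -/
theorem hasSum_family_col_stencil (hm : 0 < m) (hV : ∀ c', BiLoc (V c') ((N : ℤ) • c') ((N : ℤ) • c') C2 m)
    (hbond : ∀ (x z : Site (d + 1)) (a b : Fib d), HasSum (fun c' : Site (d + 1) => V c' x z a b) (𝒦 x z a b))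
    (hS : LocStencil S Cs m) (h₁ : ∀ y, |ρ₁ y| ≤ 1) (h₂ : ∀ w, |ρ₂ w| ≤ 1)
    (ν : Fin (d + 1)) (f g : Fib d) (c : Site (d + 1)) (κ : Fin (d + 1)) :
    HasSum (fun c' : Site (d + 1) => ∑' t : Site (d + 1), V c' t ((N : ℤ) • c) (Sum.inl κ) (Sum.inr ν) *
        ∑' yw : Site (d + 1) × Site (d + 1), ρ₁ yw.1 * ρ₂ yw.2 * S κ t yw.1 yw.2 f g)
      (∑' t : Site (d + 1), 𝒦 t ((N : ℤ) • c) (Sum.inl κ) (Sum.inr ν) * ∑' yw : Site (d + 1) × Site (d + 1), ρ₁ yw.1 * ρ₂ yw.2 * S κ t yw.1 yw.2 f g) := by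
  have hN : 1 ≤ N := Nat.one_le_iff_ne_zero.2 (NeZero.ne N)
  have hC2 : 0 ≤ C2 := (hV 0).nonneg (Sum.inl 0)
  have hCs : 0 ≤ Cs := (hS 0 0).nonneg (Sum.inl 0)
  have hZ : 0 ≤ Zl (d + 1) m * Zl (d + 1) m := mul_nonneg (Zl_nonneg hm) (Zl_nonneg hm)
  have hm1 := ((summable_exp_shift' (half_pos hm) ((N : ℤ) • c)).mul_left C2).mul_right (Cs * (Zl (d + 1) m * Zl (d + 1) m))
  have hm2 := hm1.mul_of_nonneg (summable_exp_coarse' (d := d) hN (half_pos hm) ((N : ℤ) • c))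
    (fun _ => mul_nonneg (mul_nonneg hC2 (Real.exp_pos _).le) (mul_nonneg hCs hZ)) (fun _ => (Real.exp_pos _).le)
  have hmaj : Summable fun q : Site (d + 1) × Site (d + 1) =>
      (C2 * Real.exp (-(m / 2) * l1 (q.1 - (N : ℤ) • c)) * (Cs * (Zl (d + 1) m * Zl (d + 1) m))) * Real.exp (-(m / 2) * l1 ((N : ℤ) • c - (N : ℤ) • q.2)) := hm2
  have hGs : Summable fun q : Site (d + 1) × Site (d + 1) =>
      V q.2 q.1 ((N : ℤ) • c) (Sum.inl κ) (Sum.inr ν) * ∑' yw : Site (d + 1) × Site (d + 1), ρ₁ yw.1 * ρ₂ yw.2 * S κ q.1 yw.1 yw.2 f g := by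
    refine Summable.of_norm_bounded hmaj (fun q => ?_)
    rw [Real.norm_eq_abs, abs_mul]
    have e1 := abs_family_col_le hV hm.le ν c q.2 q.1 (Sum.inl κ)
    have e2 := abs_twoFace_le hm (hS κ q.1) h₁ h₂ f g
    have e3 := mul_le_mul e1 e2 (abs_nonneg _) (mul_nonneg (mul_nonneg hC2 (Real.exp_pos _).le) (Real.exp_pos _).le)
    refine e3.trans (le_of_eq ?_)
    ring
  have hfib : ∀ t : Site (d + 1), HasSum (fun c' : Site (d + 1) => V c' t ((N : ℤ) • c) (Sum.inl κ) (Sum.inr ν) *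
      ∑' yw : Site (d + 1) × Site (d + 1), ρ₁ yw.1 * ρ₂ yw.2 * S κ t yw.1 yw.2 f g)
      (𝒦 t ((N : ℤ) • c) (Sum.inl κ) (Sum.inr ν) * ∑' yw : Site (d + 1) × Site (d + 1), ρ₁ yw.1 * ρ₂ yw.2 * S κ t yw.1 yw.2 f g) :=
    fun t => (hbond t ((N : ℤ) • c) (Sum.inl κ) (Sum.inr ν)).mul_right _
  exact hasSum_fibre_swap hGs hfib

/-- [folklore] **MULTIPLIER HALF, ONE COLOUR: THE INNER-BOND SUM THROUGH THE MULTIPLIER ENTRIES OF THE `(ν, c)`-COLUMN** — the same over `(w′, c′)`. -/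
theorem hasSum_family_col_vertexM (hm : 0 < m) (hV : ∀ c', BiLoc (V c') ((N : ℤ) • c') ((N : ℤ) • c') C2 m)
    (hbond : ∀ (x z : Site (d + 1)) (a b : Fib d), HasSum (fun c' : Site (d + 1) => V c' x z a b) (𝒦 x z a b))
    (hM : VertexFamily M N CM m) (h₁ : ∀ y, |ρ₁ y| ≤ 1) (h₂ : ∀ w, |ρ₂ w| ≤ 1)
    (ν : Fin (d + 1)) (f g : Fib d) (c : Site (d + 1)) (ρ' : Fin (d + 1)) :
    HasSum (fun c' : Site (d + 1) => ∑' w' : Site (d + 1), V c' ((N : ℤ) • w') ((N : ℤ) • c) (Sum.inr ρ') (Sum.inr ν) *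
        ∑' yw : Site (d + 1) × Site (d + 1), ρ₁ yw.1 * ρ₂ yw.2 * M ρ' w' yw.1 yw.2 f g)
      (∑' w' : Site (d + 1), 𝒦 ((N : ℤ) • w') ((N : ℤ) • c) (Sum.inr ρ') (Sum.inr ν) * ∑' yw : Site (d + 1) × Site (d + 1), ρ₁ yw.1 * ρ₂ yw.2 * M ρ' w' yw.1 yw.2 f g) := by
  have hN : 1 ≤ N := Nat.one_le_iff_ne_zero.2 (NeZero.ne N)
  have hC2 : 0 ≤ C2 := (hV 0).nonneg (Sum.inl 0)
  have hCM : 0 ≤ CM := (hM 0 0).nonneg (Sum.inl 0)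
  have hZ : 0 ≤ Zl (d + 1) m * Zl (d + 1) m := mul_nonneg (Zl_nonneg hm) (Zl_nonneg hm)
  have hm1 := ((summable_exp_coarse (d := d) hN (half_pos hm) ((N : ℤ) • c)).mul_left C2).mul_right (CM * (Zl (d + 1) m * Zl (d + 1) m))
  have hm2 := hm1.mul_of_nonneg (summable_exp_coarse' (d := d) hN (half_pos hm) ((N : ℤ) • c))
    (fun _ => mul_nonneg (mul_nonneg hC2 (Real.exp_pos _).le) (mul_nonneg hCM hZ)) (fun _ => (Real.exp_pos _).le)
  have hmaj : Summable fun q : Site (d + 1) × Site (d + 1) =>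
      (C2 * Real.exp (-(m / 2) * l1 ((N : ℤ) • q.1 - (N : ℤ) • c)) * (CM * (Zl (d + 1) m * Zl (d + 1) m))) * Real.exp (-(m / 2) * l1 ((N : ℤ) • c - (N : ℤ) • q.2)) := hm2
  have hGs : Summable fun q : Site (d + 1) × Site (d + 1) =>
      V q.2 ((N : ℤ) • q.1) ((N : ℤ) • c) (Sum.inr ρ') (Sum.inr ν) * ∑' yw : Site (d + 1) × Site (d + 1), ρ₁ yw.1 * ρ₂ yw.2 * M ρ' q.1 yw.1 yw.2 f g := by
    refine Summable.of_norm_bounded hmaj (fun q => ?_)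
    rw [Real.norm_eq_abs, abs_mul]
    have e1 := abs_family_col_le hV hm.le ν c q.2 ((N : ℤ) • q.1) (Sum.inr ρ')
    have e2 := abs_twoFace_le hm (hM ρ' q.1) h₁ h₂ f g
    have e3 := mul_le_mul e1 e2 (abs_nonneg _) (mul_nonneg (mul_nonneg hC2 (Real.exp_pos _).le) (Real.exp_pos _).le)
    refine e3.trans (le_of_eq ?_)
    ring
  have hfib : ∀ w' : Site (d + 1), HasSum (fun c' : Site (d + 1) => V c' ((N : ℤ) • w') ((N : ℤ) • c) (Sum.inr ρ') (Sum.inr ν) *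
      ∑' yw : Site (d + 1) × Site (d + 1), ρ₁ yw.1 * ρ₂ yw.2 * M ρ' w' yw.1 yw.2 f g)
      (𝒦 ((N : ℤ) • w') ((N : ℤ) • c) (Sum.inr ρ') (Sum.inr ν) * ∑' yw : Site (d + 1) × Site (d + 1), ρ₁ yw.1 * ρ₂ yw.2 * M ρ' w' yw.1 yw.2 f g) :=
    fun w' => (hbond ((N : ℤ) • w') ((N : ℤ) • c) (Sum.inr ρ') (Sum.inr ν)).mul_right _
  exact hasSum_fibre_swap hGs hfib

/-- [folklore] **THE INNER-BOND SUM OF THE TWO-FACE WORD THROUGH THE COLUMNS** (generic): `V c′` bi-localised at `N•c′` with one constant (rate `m > 0`), pointwise bond sum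
`Σ'_{c′} V c′ = 𝒦`, `S` `LocStencil` ∕ `M` `VertexFamily` at rate `m`, bounded weights ⟹ for every bond `c`,
`HasSum (c′ ↦ Σ'_{(y,w)} ρ₁ρ₂·dM (V c′) N S M ν c y w f g) (Σ_κ Σ'_t 𝒦(t, N•c)(inl κ, inr ν)·Φ_κ(t) + Σ_{ρ′} Σ'_{w′} 𝒦(N•w′, N•c)(inr ρ′, inr ν)·Ψ_{ρ′}(w′))` (each summand by 36
`tsum_twoFace_dM_col`). -/
theorem hasSum_word_inner_col (hm : 0 < m) (hV : ∀ c', BiLoc (V c') ((N : ℤ) • c') ((N : ℤ) • c') C2 m)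
    (hbond : ∀ (x z : Site (d + 1)) (a b : Fib d), HasSum (fun c' : Site (d + 1) => V c' x z a b) (𝒦 x z a b))
    (hS : LocStencil S Cs m) (hM : VertexFamily M N CM m) (h₁ : ∀ y, |ρ₁ y| ≤ 1) (h₂ : ∀ w, |ρ₂ w| ≤ 1)
    (ν : Fin (d + 1)) (f g : Fib d) (c : Site (d + 1)) :
    HasSum (fun c' : Site (d + 1) => ∑' yw : Site (d + 1) × Site (d + 1), ρ₁ yw.1 * ρ₂ yw.2 * dM (V c') N S M ν c yw.1 yw.2 f g)
      ((∑ κ : Fin (d + 1), ∑' t : Site (d + 1), 𝒦 t ((N : ℤ) • c) (Sum.inl κ) (Sum.inr ν) *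
          ∑' yw : Site (d + 1) × Site (d + 1), ρ₁ yw.1 * ρ₂ yw.2 * S κ t yw.1 yw.2 f g) +
        ∑ ρ' : Fin (d + 1), ∑' w' : Site (d + 1), 𝒦 ((N : ℤ) • w') ((N : ℤ) • c) (Sum.inr ρ') (Sum.inr ν) *
          ∑' yw : Site (d + 1) × Site (d + 1), ρ₁ yw.1 * ρ₂ yw.2 * M ρ' w' yw.1 yw.2 f g) := by
  have h := (hasSum_sum fun κ (_ : κ ∈ (Finset.univ : Finset (Fin (d + 1)))) => hasSum_family_col_stencil hm hV hbond hS h₁ h₂ ν f g c κ).add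
    (hasSum_sum fun ρ' (_ : ρ' ∈ (Finset.univ : Finset (Fin (d + 1)))) => hasSum_family_col_vertexM hm hV hbond hM h₁ h₂ ν f g c ρ')
  refine h.congr_fun fun c' => ?_
  exact tsum_twoFace_dM_col (N := N) (decays_of_biLoc (hV c') hm.le) hm hS hM h₁ h₂ ν c f g

end Generic

/-! ## §3 The word in cell form -/

/-- [folklore] **THE OUTER-SUMMED SECOND-RESPONSE WORD IN CELL FORM** (in-block root, `1 ≤ Lc`, every `j`, all units; block-covariant `S`, covariant `M`, bounded periodic weights;
every bond `c`, every fibre pair):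
`Σ'_{u′} Σ'_{(y,w)} ρ₁(y)ρ₂(w)·dM (K2OfK X̃♮_j Lc S M μ c) Lc S M ν u′ y w f g = Σ_{r∈box Lc} Σ_κ chg^{𝒦_μ}_ν(inl κ, r)·Φ_κ(r) + Σ_{ρ′} chg^{𝒦_μ}_ν(inr ρ′, 0)·Ψ_{ρ′}(0)`,
`chg^{𝒦_μ}_ν(g, t) = −Σ'_{s′} Σ_b (X̃♮_j ∘ 𝒮_μ)(t, s′)(g, b)·chg_ν(b, s′)` (37 `hasSum_respKernel_col`). -/
theorem tsum_respWord_eq_cell (hLc : 1 ≤ Lc) (hr : r ∈ box (d + 1) Lc) (sf sm : ℝ) (j : ℕ)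
    (hS : LocStencil S Cs δs) (hδs : 0 < δs) (hScov : ∀ (κ : Fin (d + 1)) (u t : Site (d + 1)), S κ (u + (Lc : ℤ) • t) = shiftK (-((Lc : ℤ) • t)) (S κ u))
    (hM : VertexFamily M Lc CM δM) (hδM : 0 < δM) (hMcov : ∀ (ρ' : Fin (d + 1)) (w t : Site (d + 1)), M ρ' (w + t) = shiftK (-((Lc : ℤ) • t)) (M ρ' w))
    (h₁ : ∀ y, |ρ₁ y| ≤ 1) (h₂ : ∀ w, |ρ₂ w| ≤ 1)
    (hρ₁ : ∀ y s : Site (d + 1), ρ₁ (y + (Lc : ℤ) • s) = ρ₁ y) (hρ₂ : ∀ w s : Site (d + 1), ρ₂ (w + (Lc : ℤ) • s) = ρ₂ w)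
    (μ ν : Fin (d + 1)) (f g : Fib d) (c : Site (d + 1)) :
    (∑' u' : Site (d + 1), ∑' yw : Site (d + 1) × Site (d + 1), ρ₁ yw.1 * ρ₂ yw.2 *
        dM (K2OfK (unitK sf sm (coDressKBmAt (toSite r) Lc (KInvStep (d := d) Lc j))) Lc S M μ c) Lc S M ν u' yw.1 yw.2 f g) =
      (∑ r' ∈ box (d + 1) Lc, ∑ κ : Fin (d + 1),
          (-(∑' s' : Site (d + 1), ∑ b : Fib d,
              comp (unitK sf sm (coDressKBmAt (toSite r) Lc (KInvStep (d := d) Lc j)))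
                (fun x z a b => ((Lc : ℝ) * (sm * sf)) * ((((Lc ^ (j + 1) : ℕ) : ℝ)) ^ (d + 1 + 1))⁻¹ *
                  ∑' t : Site (d + 1), (if t μ % (Lc : ℤ) = (Lc : ℤ) - 1 then S μ t x z a b else 0)) (toSite r') s' (Sum.inl κ) b *
                Sum.elim (fun a : Fin (d + 1) => if s' a % (Lc : ℤ) = (Lc : ℤ) - 1 then ((Lc : ℝ) * (sm * sf)) *
                  (if a = ν then ((((Lc ^ (j + 1) : ℕ) : ℝ)) ^ (d + 1 + 1))⁻¹ else 0) else 0) (fun _ => (0 : ℝ)) b)) *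
            ∑' yw : Site (d + 1) × Site (d + 1), ρ₁ yw.1 * ρ₂ yw.2 * S κ (toSite r') yw.1 yw.2 f g) +
        ∑ ρ' : Fin (d + 1),
          (-(∑' s' : Site (d + 1), ∑ b : Fib d,
              comp (unitK sf sm (coDressKBmAt (toSite r) Lc (KInvStep (d := d) Lc j)))
                (fun x z a b => ((Lc : ℝ) * (sm * sf)) * ((((Lc ^ (j + 1) : ℕ) : ℝ)) ^ (d + 1 + 1))⁻¹ *
                  ∑' t : Site (d + 1), (if t μ % (Lc : ℤ) = (Lc : ℤ) - 1 then S μ t x z a b else 0)) 0 s' (Sum.inr ρ') b *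
                Sum.elim (fun a : Fin (d + 1) => if s' a % (Lc : ℤ) = (Lc : ℤ) - 1 then ((Lc : ℝ) * (sm * sf)) *
                  (if a = ν then ((((Lc ^ (j + 1) : ℕ) : ℝ)) ^ (d + 1 + 1))⁻¹ else 0) else 0) (fun _ => (0 : ℝ)) b)) *
            ∑' yw : Site (d + 1) × Site (d + 1), ρ₁ yw.1 * ρ₂ yw.2 * M ρ' 0 yw.1 yw.2 f g := by
  -- one rate for `X̃`, `K2`, `𝒦_μ`, `S`, `M`
  obtain ⟨δ, C, hδ, hC, hXd⟩ := decays_coDressKBmAt hLc hr (decays_KInvStep (d := d) (Lc := Lc) j)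
  have hXu := decays_unitK (sf := sf) (sm := sm) hXd
  have hCX : 0 ≤ max |sf| |sm| * C * max |sf| |sm| := by positivity
  obtain ⟨CK, mK, hmK, hCK, hK⟩ := exists_decays_respKernel (d := d) hLc hr sf sm j hS hδs μ
  have hCs : 0 ≤ Cs := (hS 0 0).nonneg (Sum.inl 0)
  have hCM : 0 ≤ CM := (hM 0 0).nonneg (Sum.inl 0)
  have hm : 0 < min (min (min δ mK) δs) δM := lt_min (lt_min (lt_min hδ hmK) hδs) hδM
  have hX1 : Decays (unitK sf sm (coDressKBmAt (toSite r) Lc (KInvStep (d := d) Lc j))) (max |sf| |sm| * C * max |sf| |sm|) (min (min (min δ mK) δs) δM) :=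
    decays_mono hXu hCX le_rfl (((min_le_left _ _).trans (min_le_left _ _)).trans (min_le_left _ _))
  have hK1 := decays_mono hK hCK le_rfl (((min_le_left _ _).trans (min_le_left _ _)).trans (min_le_right _ _) : min (min (min δ mK) δs) δM ≤ mK)
  have hS1 := locStencil_mono hS hCs ((min_le_left _ _).trans (min_le_right _ _) : min (min (min δ mK) δs) δM ≤ δs)
  have hM1 : VertexFamily M Lc CM (min (min (min δ mK) δs) δM) := fun ρ' w' => biLoc_mono (hM ρ' w') hCM (min_le_right _ _)
  have hK2 := vertexFamily_K2OfK (N := Lc) hX1 hCX hm hS1 hM1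
  have hK8 := decays_mono hK1 hCK le_rfl (by linarith : min (min (min δ mK) δs) δM / 8 ≤ min (min (min δ mK) δs) δM)
  have hS8 := locStencil_mono hS1 hCs (by linarith : min (min (min δ mK) δs) δM / 8 ≤ min (min (min δ mK) δs) δM)
  have hM8 : VertexFamily M Lc CM (min (min (min δ mK) δs) δM / 8) := fun ρ' w' => biLoc_mono (hM1 ρ' w') hCM (by linarith)
  have hKcov := shiftK_respKernel (d := d) (r := r) hLc sf sm j hScov μ
  have hcol := hasSum_respKernel_col (d := d) hLc hr sf sm j hS hδs μ ν
  rw [tsum_respWord_outer_eq_inner hLc sf sm j hScov hMcov hρ₁ hρ₂ μ ν f g c,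
    (hasSum_word_inner_col (N := Lc) (by positivity) (hK2 μ) (fun x z a b => hasSum_K2OfK_dressedStep_bond hLc hr sf sm j hS hδs hM hδM μ x z a b)
      hS8 hM8 h₁ h₂ ν f g c).tsum_eq,
    tsum_col_twoFace_eq_sum_box (N := Lc) hK8 (by positivity) hKcov ν (fun g' t => hcol t g') hS8 hScov h₁ h₂ hρ₁ hρ₂ c f g,
    tsum_colM_twoFace_eq_charge (N := Lc) hKcov ν (fun g' t => hcol t g') hMcov hρ₁ hρ₂ c f g]

end Summit.QuantumFields.BalabanUV.Beta.GAN24.RespWordCellForm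

end
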